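import Mathlib
import HarnessLib.Audit
import Summits.PneNP.PneNP.Theorems.PstarChordSystem

/-!
# Gate symmetries of a chord system: the gated free lunch and the transversal corner (ROUND-24, memo §10 R6 / §10.1, O2)

FRONTIER range-avoidance ladder, rung F-N3, ROUND 24 (cell `pnp-ideate`, planner memo `r24/CORE-BOUND-NOTES.md` §10 (R6 "no free lunch",
"NON-CONSTANT READS (part of O2)"), §10.1 (the gate-read family), §13.2 (the maximal-sharing regime, where every private-touching reader is a
gate `(p_e, z)` with `z` OUTSIDE the core); typed target `PstarCoreBoundTargets.TerminalFiveA` / `TerminalFiveMaxSharing`; restricted-model proof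
complexity — nothing here bears on `P` versus `NP`).

MECHANISM-FREE.  A GATE on the chord `e₀` of a `ChordSystem` (`PstarChordSystem`) is a map `φ : A → A` of base points ("flip the gate variable
`z`") that preserves every prescribed product (`u e (φ a) = u e a`: the same states are admissible at `a` and at `φ a`), preserves the read
vectors of every other chord and of the second private of `e₀`, shifts the read vector of the first private of `e₀` by a fixed `d ∈ 𝔽₂²`
(`ρ e₀ (φ a) = ρ e₀ a + d`: the reader `(p_{e₀}, z)` folded into the constraint(s) `d`), and shifts the state-free part by `δ a`
(`F (φ a) = F a + δ a`: the other occurrences of `z`; `δ = 0` for an ISOLATED gate variable).  In the instance (`PstarChordBridge.sys`) this is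
exactly a monomial reader `(p_{e₀}, z)` with `z` not a variable of the core: `z` is a base coordinate on which no prescribed product depends.

Results (`δ a = 0` where used; `d ≠ 0`):
* `val_shift` — `val E (φ a) s = val E a s + δ a + (s e₀).1 • d`;
* `free_lunch_of_gate` — **the gated free lunch**: if the reads of `e₀` are PARALLEL to `d` (`ρ e₀ a, ρ' e₀ a ∈ {0, d}` everywhere) then an
  infeasible system is infeasible MODULO `d`: no admissible state hits `t + d` either (memo R6 is the case of a constant free bit; here the free
  bit is available through the state `p_{e₀} = 1` of a killable `e₀` or through a forced `e₀`) — in the instance this puts the whole infeasibility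
  on ONE G-constraint, which `PstarGSat.gSat` forbids;
* `unread_of_transversal` — **the transversal corner**: if at a base point where `e₀` is killable one of its reads is NOT in `{0, d}`, then
  every other chord killable there is unread there (the configurations of `e₀` alone realise three of the four values of `𝔽₂²`);
* `eq_of_transversal` — hence, with CONSTANT reads of the other chords, pairwise killability (memo R4, `PstarChordBridgeKill.killable_pair` in
  the instance) and chord-minimality of every chord (M-read), a transversally read gated chord is the ONLY chord: `E = {e₀}`;
* `swap` — exchanging the two privates of `e₀` (for gates on the second private): `infeasible_swap`, `chordMinimal_swap`, `Gate.swap`.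
-/

set_option linter.dupNamespace false -- `Summit.PneNP.PneNP.…`: summit = sub-problem name (D-0017 single-conjunct layout)

open Finset
open Summit.PneNP.PneNP.Theorems.PstarReadSumset (V2)
open Summit.PneNP.PneNP.Theorems.PstarChordSystem (ChordSystem)

namespace Summit.PneNP.PneNP.Theorems.PstarChordSystemGate

/-- Every element of `𝔽₂` is `0` or `1`. -/
private theorem zmod2_cases (t : ZMod 2) : t = 0 ∨ t = 1 := by
  revert t; decide

variable {ι A : Type*} [DecidableEq ι]

/-! ## Gate symmetries -/

/-- **A gate on the chord `e₀`**: a map of base points preserving the prescribed products and all reads except that of the first private of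
`e₀`, which it shifts by `d`; the state-free part shifts by `δ`. -/
structure Gate (S : ChordSystem ι A) (φ : A → A) (e₀ : ι) (d : V2) (δ : A → V2) : Prop where
  /-- prescribed products are preserved -/
  hu : ∀ e a, S.u e (φ a) = S.u e a
  /-- the state-free part shifts by `δ` -/
  hF : ∀ a, S.F (φ a) = S.F a + δ a
  /-- reads of the other chords are preserved -/
  hρ : ∀ e a, e ≠ e₀ → S.ρ e (φ a) = S.ρ e a
  /-- reads of second privates are preserved -/
  hρ' : ∀ e a, S.ρ' e (φ a) = S.ρ' e a
  /-- the read of the first private of `e₀` shifts by `d` -/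
  hρ₀ : ∀ a, S.ρ e₀ (φ a) = S.ρ e₀ a + d

namespace Gate

variable {S : ChordSystem ι A} {φ : A → A} {e₀ : ι} {d : V2} {δ : A → V2}

omit [DecidableEq ι] in
/-- Admissibility is the same at `a` and at `φ a`. -/
theorem adm_iff (G : Gate S φ e₀ d δ) (E : Finset ι) (a : A) (s : ι → ZMod 2 × ZMod 2) : S.Adm E (φ a) s ↔ S.Adm E a s := by
  unfold ChordSystem.Adm
  simp only [G.hu]

omit [DecidableEq ι] in
/-- The contribution of a chord other than `e₀` is preserved. -/
theorem contrib_of_ne (G : Gate S φ e₀ d δ) (a : A) (s : ι → ZMod 2 × ZMod 2) {e : ι} (he : e ≠ e₀) :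
    S.contrib (φ a) s e = S.contrib a s e := by
  unfold ChordSystem.contrib
  rw [G.hρ e a he, G.hρ' e a]

omit [DecidableEq ι] in
/-- The contribution of `e₀` shifts by `(s e₀).1 • d`. -/
theorem contrib_self (G : Gate S φ e₀ d δ) (a : A) (s : ι → ZMod 2 × ZMod 2) :
    S.contrib (φ a) s e₀ = S.contrib a s e₀ + (s e₀).1 • d := by
  unfold ChordSystem.contrib
  rw [G.hρ₀ a, G.hρ' e₀ a, smul_add]
  abel

/-- **The value shift**: `val E (φ a) s = val E a s + δ a + (s e₀).1 • d` (`e₀ ∈ E`). -/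
theorem val_shift (G : Gate S φ e₀ d δ) {E : Finset ι} (he₀ : e₀ ∈ E) (a : A) (s : ι → ZMod 2 × ZMod 2) :
    S.val E (φ a) s = S.val E a s + δ a + (s e₀).1 • d := by
  rw [S.val_eq he₀, S.val_eq he₀, G.contrib_self]
  unfold ChordSystem.val
  rw [G.hF a, sum_congr rfl fun e he => G.contrib_of_ne a s (ne_of_mem_erase he)]
  abel

omit [DecidableEq ι] in
/-- The value shift off `E`: if `e₀ ∉ E` only the state-free part moves. -/
theorem val_shift_of_not_mem (G : Gate S φ e₀ d δ) {E : Finset ι} (he₀ : e₀ ∉ E) (a : A) (s : ι → ZMod 2 × ZMod 2) :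
    S.val E (φ a) s = S.val E a s + δ a := by
  unfold ChordSystem.val
  rw [G.hF a, sum_congr rfl fun e he => G.contrib_of_ne a s (fun h => he₀ (h ▸ he))]
  abel

end Gate

/-! ## The gated free lunch -/

/-- In `𝔽₂²`: the sum of two elements of `{0, d}` lies in `{0, d}`. -/
private theorem mem_pair_add {x y d : V2} (hx : x = 0 ∨ x = d) (hy : y = 0 ∨ y = d) : x + y = 0 ∨ x + y = d := by
  rcases hx with hx | hx <;> rcases hy with hy | hy <;> rw [hx, hy]
  · exact Or.inl (add_zero 0)
  · exact Or.inr (zero_add d)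
  · exact Or.inr (add_zero d)
  · exact Or.inl (PstarReadSumset.add_self d)

/-- **The gated free lunch.**  A gate on `e₀ ∈ E` with isolated gate variable (`δ = 0`) whose chord is read PARALLEL to the gate direction
(`ρ e₀ a, ρ' e₀ a ∈ {0, d}` at every base point): if the system is infeasible then no admissible state hits `t + d` either.  (At a state with
`p_{e₀} = 1` flip the gate; at a state with `p_{e₀} = 0` the chord is killable, switch to the state `(1, 0)` and flip the gate or not.) -/
theorem free_lunch_of_gate {S : ChordSystem ι A} {φ : A → A} {e₀ : ι} {d : V2} {δ : A → V2} (G : Gate S φ e₀ d δ)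
    (hδ : ∀ a, δ a = 0) (hpar : ∀ a, (S.ρ e₀ a = 0 ∨ S.ρ e₀ a = d) ∧ (S.ρ' e₀ a = 0 ∨ S.ρ' e₀ a = d)) {E : Finset ι}
    (hI : S.Infeasible E) (he₀ : e₀ ∈ E) : ∀ a s, S.Adm E a s → S.val E a s ≠ S.t + d := by
  intro a s hadm hval
  rcases zmod2_cases (s e₀).1 with h0 | h1
  · -- `p_{e₀} = 0`: the chord is killable here
    obtain ⟨b, hb⟩ : ∃ b, s e₀ = (0, b) := ⟨(s e₀).2, Prod.ext h0 rfl⟩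
    have hu : S.u e₀ a = 0 := by rw [← hadm e₀ he₀, hb, zero_mul]
    have hrest : S.val (E.erase e₀) a s = S.t + d + b • S.ρ' e₀ a := by
      have h := S.val_eq he₀ a s
      rw [hval] at h
      unfold ChordSystem.contrib at h
      rw [hb, zero_smul, zero_add] at h
      have : ∀ x y z : V2, x = y + z → z = x + y := by
        intro x y z h; rw [h, add_comm y z, add_assoc, PstarReadSumset.add_self, add_zero]
      exact this _ _ _ h
    -- switch `e₀` to the state `(1, 0)`
    set s' := Function.update s e₀ ((1 : ZMod 2), (0 : ZMod 2)) with hs'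
    have hadm' : S.Adm E a s' := S.adm_update (S.adm_erase hadm e₀) (by rw [one_mul, hu])
    have hval' : S.val E a s' = S.ρ e₀ a + b • S.ρ' e₀ a + S.t + d := by
      rw [S.val_eq he₀, S.val_erase_update, S.contrib_update_self, one_smul, zero_smul, add_zero, hrest]
      abel
    have hw : S.ρ e₀ a + b • S.ρ' e₀ a = 0 ∨ S.ρ e₀ a + b • S.ρ' e₀ a = d := by
      refine mem_pair_add (hpar a).1 ?_
      rcases zmod2_cases b with rfl | rfl
      · exact Or.inl (zero_smul _ _)
      · rw [one_smul]; exact (hpar a).2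
    rcases hw with hw | hw
    · -- flip the gate: the value at `φ a` is `t`
      refine hI (φ a) s' ((G.adm_iff E a s').2 hadm') ?_
      rw [G.val_shift he₀, hval', hδ, hs', Function.update_self, one_smul, add_zero, hw, zero_add, add_assoc,
        PstarReadSumset.add_self, add_zero]
    · -- no flip needed: the value at `a` is `t`
      refine hI a s' hadm' ?_
      rw [hval', hw, add_comm d, add_assoc, PstarReadSumset.add_self, add_zero]
  · -- `p_{e₀} = 1`: flip the gate
    refine hI (φ a) s ((G.adm_iff E a s).2 hadm) ?_
    rw [G.val_shift he₀, hval, hδ, h1, one_smul, add_zero, add_assoc, PstarReadSumset.add_self, add_zero]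

/-! ## The transversal corner -/

/-- `{0, u, v}` with `u, v` distinct and non-zero, together with its translate by a non-zero `y`, covers `𝔽₂²`. -/
private theorem cover_of_three (u v y w : V2) (hu : u ≠ 0) (hv : v ≠ 0) (huv : u ≠ v) (hy : y ≠ 0) :
    w = 0 ∨ w = u ∨ w = v ∨ w = y ∨ w = u + y ∨ w = v + y := by
  revert u v y w
  decide

/-- In `𝔽₂²`: if `d ≠ 0` and `p ≠ d` then `p + d ≠ 0` and `p ≠ p + d`. -/
private theorem add_ne_facts (p d : V2) (hd : d ≠ 0) (hp : p ≠ d) : p + d ≠ 0 ∧ p ≠ p + d := by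
  revert p d
  decide

/-- Values of the two-chord configurations: base state `s`, chord `e` set to `x`, chord `e₀` set to `x₀`, at `a` and at `φ a`. -/
private theorem val_config {S : ChordSystem ι A} {φ : A → A} {e₀ : ι} {d : V2} {δ : A → V2} (G : Gate S φ e₀ d δ) {E : Finset ι}
    (he₀ : e₀ ∈ E) {e : ι} (he : e ∈ E) (hne : e ≠ e₀) (a : A) (s : ι → ZMod 2 × ZMod 2) (x₀ x : ZMod 2 × ZMod 2) :
    S.val E a (Function.update (Function.update s e x) e₀ x₀) =
        S.val ((E.erase e₀).erase e) a s + (x₀.1 • S.ρ e₀ a + x₀.2 • S.ρ' e₀ a) + (x.1 • S.ρ e a + x.2 • S.ρ' e a) ∧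
      S.val E (φ a) (Function.update (Function.update s e x) e₀ x₀) =
        S.val ((E.erase e₀).erase e) a s + (x₀.1 • S.ρ e₀ a + x₀.2 • S.ρ' e₀ a) + (x.1 • S.ρ e a + x.2 • S.ρ' e a) + δ a + x₀.1 • d := by
  have he' : e ∈ E.erase e₀ := mem_erase.2 ⟨hne, he⟩
  have key : S.val E a (Function.update (Function.update s e x) e₀ x₀) =
      S.val ((E.erase e₀).erase e) a s + (x₀.1 • S.ρ e₀ a + x₀.2 • S.ρ' e₀ a) + (x.1 • S.ρ e a + x.2 • S.ρ' e a) := by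
    rw [S.val_eq he₀, S.contrib_update_self, S.val_erase_update, S.val_eq he', S.contrib_update_self, S.val_erase_update]
    abel
  refine ⟨key, ?_⟩
  rw [G.val_shift he₀, key, Function.update_self]

/-- **The transversal corner.**  A gate on `e₀ ∈ E` (`d ≠ 0`, `δ a = 0` at the base point `a`), the system infeasible, `e₀` killable at `a`
and read there TRANSVERSALLY (`ρ e₀ a ∉ {0, d}` or `ρ' e₀ a ∉ {0, d}`): then every other chord of `E` killable at `a` is unread at `a`.
(The configurations of `e₀` — states `0, p, p'` at `a` and at `φ a` — realise three distinct values; a non-zero read of a second killable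
chord would realise the fourth.) -/
theorem unread_of_transversal {S : ChordSystem ι A} {φ : A → A} {e₀ : ι} {d : V2} {δ : A → V2} (G : Gate S φ e₀ d δ) (hd : d ≠ 0)
    {E : Finset ι} (hI : S.Infeasible E) (he₀ : e₀ ∈ E) {a : A} (hδ : δ a = 0) (hu₀ : S.u e₀ a = 0)
    (htr : ¬ (S.ρ e₀ a = 0 ∨ S.ρ e₀ a = d) ∨ ¬ (S.ρ' e₀ a = 0 ∨ S.ρ' e₀ a = d))
    {e : ι} (he : e ∈ E) (hne : e ≠ e₀) (hu : S.u e a = 0) : S.ρ e a = 0 ∧ S.ρ' e a = 0 := by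
  -- the canonical admissible state, then `e` and `e₀` overwritten
  set s₀ : ι → ZMod 2 × ZMod 2 := fun e' => (S.u e' a, 1) with hs₀
  have hadm₀ : S.Adm E a s₀ := fun e' _ => by simp [hs₀]
  set R := S.val ((E.erase e₀).erase e) a s₀ with hR
  -- every configuration with killed states misses `t`, at `a` and at `φ a`
  have miss : ∀ x₀ x : ZMod 2 × ZMod 2, x₀.1 * x₀.2 = 0 → x.1 * x.2 = 0 →
      R + (x₀.1 • S.ρ e₀ a + x₀.2 • S.ρ' e₀ a) + (x.1 • S.ρ e a + x.2 • S.ρ' e a) ≠ S.t ∧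
      R + (x₀.1 • S.ρ e₀ a + x₀.2 • S.ρ' e₀ a) + (x.1 • S.ρ e a + x.2 • S.ρ' e a) + x₀.1 • d ≠ S.t := by
    intro x₀ x hx₀ hx
    have hadm : S.Adm E a (Function.update (Function.update s₀ e x) e₀ x₀) :=
      S.adm_update (S.adm_erase (S.adm_update (S.adm_erase hadm₀ e) (by rw [hx, hu])) e₀) (by rw [hx₀, hu₀])
    obtain ⟨h₁, h₂⟩ := val_config G he₀ he hne a s₀ x₀ x
    refine ⟨fun h => hI a _ hadm (h₁.trans h), fun h => hI (φ a) _ ((G.adm_iff E a _).2 hadm) ?_⟩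
    rw [h₂, hδ, add_zero]
    exact h
  -- write the target as `t = R + w`; every realisable `X + Y` misses `w`
  obtain ⟨w, hw⟩ : ∃ w, S.t = R + w := ⟨R + S.t, by rw [← add_assoc, PstarReadSumset.add_self, zero_add]⟩
  have missw : ∀ x₀ x : ZMod 2 × ZMod 2, x₀.1 * x₀.2 = 0 → x.1 * x.2 = 0 →
      (x₀.1 • S.ρ e₀ a + x₀.2 • S.ρ' e₀ a) + (x.1 • S.ρ e a + x.2 • S.ρ' e a) ≠ w ∧
      (x₀.1 • S.ρ e₀ a + x₀.2 • S.ρ' e₀ a) + (x.1 • S.ρ e a + x.2 • S.ρ' e a) + x₀.1 • d ≠ w := by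
    intro x₀ x hx₀ hx
    obtain ⟨h₁, h₂⟩ := miss x₀ x hx₀ hx
    rw [hw, add_assoc R, Ne, add_right_inj] at h₁
    rw [hw, add_assoc R, add_assoc R, Ne, add_right_inj] at h₂
    exact ⟨h₁, h₂⟩
  by_contra hread
  -- a non-zero read `y` of `e`, realised by a killed state `x` of `e`
  obtain ⟨x, y, hx, hxy, hy⟩ : ∃ (x : ZMod 2 × ZMod 2) (y : V2), x.1 * x.2 = 0 ∧ x.1 • S.ρ e a + x.2 • S.ρ' e a = y ∧ y ≠ 0 := by
    by_cases h : S.ρ e a = 0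
    · exact ⟨(0, 1), S.ρ' e a, by simp, by simp, fun h' => hread ⟨h, h'⟩⟩
    · exact ⟨(1, 0), S.ρ e a, by simp, by simp, h⟩
  -- the six values `0, ρ₀, ρ₀ + d, ρ₀'` (+ `y`) all miss `w`
  have f1 : (0 : V2) ≠ w := by
    have := (missw (0, 0) (0, 0) (by simp) (by simp)).1; simpa using this
  have f2 : S.ρ e₀ a ≠ w := by
    have := (missw (1, 0) (0, 0) (by simp) (by simp)).1; simpa using this
  have f3 : S.ρ e₀ a + d ≠ w := by
    have := (missw (1, 0) (0, 0) (by simp) (by simp)).2; simpa using this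
  have f4 : y ≠ w := by
    have := (missw (0, 0) x (by simp) hx).1; rw [hxy] at this; simpa using this
  have f5 : S.ρ e₀ a + y ≠ w := by
    have := (missw (1, 0) x (by simp) hx).1; rw [hxy] at this; simpa using this
  have f6 : S.ρ e₀ a + y + d ≠ w := by
    have := (missw (1, 0) x (by simp) hx).2; rw [hxy] at this; simpa using this
  have g3 : S.ρ' e₀ a ≠ w := by
    have := (missw (0, 1) (0, 0) (by simp) (by simp)).1; simpa using this
  have g6 : S.ρ' e₀ a + y ≠ w := by
    have := (missw (0, 1) x (by simp) hx).1; rw [hxy] at this; simpa using this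
  by_cases hA : S.ρ e₀ a = 0 ∨ S.ρ e₀ a = d
  · -- `ρ₀ ∈ {0, d}`: then `ρ₀'` is transversal, and the three values are `0, d, ρ₀'`
    have hB : ¬ (S.ρ' e₀ a = 0 ∨ S.ρ' e₀ a = d) := htr.resolve_left (not_not_intro hA)
    push Not at hB
    have g2 : d ≠ w := by
      rcases hA with h | h
      · have := f3; rw [h, zero_add] at this; exact this
      · rw [← h]; exact f2
    have g5 : d + y ≠ w := by
      rcases hA with h | h
      · have := f6; rw [h, zero_add, add_comm] at this; exact this
      · rw [← h]; exact f5
    rcases cover_of_three d (S.ρ' e₀ a) y w hd hB.1 (Ne.symm hB.2) hy with h | h | h | h | h | h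
    · exact f1 h.symm
    · exact g2 h.symm
    · exact g3 h.symm
    · exact f4 h.symm
    · exact g5 h.symm
    · exact g6 h.symm
  · -- `ρ₀` transversal: the three values are `0, ρ₀, ρ₀ + d`
    push Not at hA
    obtain ⟨h0d, hdd⟩ := add_ne_facts (S.ρ e₀ a) d hd hA.2
    rcases cover_of_three (S.ρ e₀ a) (S.ρ e₀ a + d) y w hA.1 h0d hdd hy with h | h | h | h | h | h
    · exact f1 h.symm
    · exact f2 h.symm
    · exact f3 h.symm
    · exact f4 h.symm
    · exact f5 h.symm
    · exact f6 (by rw [h, add_right_comm])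

/-- **A transversally read gated chord is the only chord.**  Gate on `e₀ ∈ E` (`d ≠ 0`, `δ = 0`), infeasible system, `e₀` read transversally
to `d` at every base point where it is killable, every OTHER chord with base-independent reads, every two distinct chords killable at a common
base point (memo R4), and every chord chord-minimal (memo (M0)): then `E = {e₀}`. -/
theorem eq_of_transversal {S : ChordSystem ι A} {φ : A → A} {e₀ : ι} {d : V2} {δ : A → V2} (G : Gate S φ e₀ d δ) (hd : d ≠ 0)
    (hδ : ∀ a, δ a = 0) {E : Finset ι} (hI : S.Infeasible E) (he₀ : e₀ ∈ E)
    (htr : ∀ a, S.u e₀ a = 0 → ¬ (S.ρ e₀ a = 0 ∨ S.ρ e₀ a = d) ∨ ¬ (S.ρ' e₀ a = 0 ∨ S.ρ' e₀ a = d))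
    (hconst : ∀ e ∈ E, e ≠ e₀ → ∀ a a', S.ρ e a = S.ρ e a' ∧ S.ρ' e a = S.ρ' e a')
    (hK : ∀ e ∈ E, ∀ e' ∈ E, e ≠ e' → ∃ a, S.u e a = 0 ∧ S.u e' a = 0) (hM : ∀ e ∈ E, S.ChordMinimal E e) :
    ∀ e ∈ E, e = e₀ := by
  intro e he
  by_contra hne
  obtain ⟨a, hu₀, hu⟩ := hK e₀ he₀ e he (Ne.symm hne)
  obtain ⟨h₁, h₂⟩ := unread_of_transversal G hd hI he₀ (hδ a) hu₀ (htr a hu₀) he hne hu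
  obtain ⟨a', -, -, -, hR⟩ := S.read_of_chordMinimal hI he (hM e he)
  rcases hR with h | h
  · exact h (((hconst e he hne a' a).1).trans h₁)
  · exact h (((hconst e he hne a' a).2).trans h₂)

/-- **A second gated chord is impossible next to a transversal one.**  If besides the transversal gate on `e₀` some other chord `e₁ ∈ E`
carries its own gate `φ₁` (isolated: `δ₁ = 0`, direction `d₁ ≠ 0`) commuting with the products, then `e₀, e₁` are never commonly killable —
so pairwise killability (memo R4) is violated.  (At `a` or at `φ₁ a` the chord `e₁` is read, and both points have the same products.) -/
theorem not_killable_of_two_gates {S : ChordSystem ι A} {φ φ₁ : A → A} {e₀ e₁ : ι} {d d₁ : V2} {δ δ₁ : A → V2}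
    (G : Gate S φ e₀ d δ) (hd : d ≠ 0) (hδ : ∀ a, δ a = 0) (G₁ : Gate S φ₁ e₁ d₁ δ₁) (hd₁ : d₁ ≠ 0)
    {E : Finset ι} (hI : S.Infeasible E) (he₀ : e₀ ∈ E) (he₁ : e₁ ∈ E) (hne : e₁ ≠ e₀)
    (htr : ∀ a, S.u e₀ a = 0 → ¬ (S.ρ e₀ a = 0 ∨ S.ρ e₀ a = d) ∨ ¬ (S.ρ' e₀ a = 0 ∨ S.ρ' e₀ a = d)) (a : A) :
    ¬ (S.u e₀ a = 0 ∧ S.u e₁ a = 0) := by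
  rintro ⟨hu₀, hu₁⟩
  obtain ⟨h₁, -⟩ := unread_of_transversal G hd hI he₀ (hδ a) hu₀ (htr a hu₀) he₁ hne hu₁
  have hu₀' : S.u e₀ (φ₁ a) = 0 := by rw [G₁.hu]; exact hu₀
  have hu₁' : S.u e₁ (φ₁ a) = 0 := by rw [G₁.hu]; exact hu₁
  obtain ⟨h₁', -⟩ := unread_of_transversal G hd hI he₀ (hδ (φ₁ a)) hu₀' (htr (φ₁ a) hu₀') he₁ hne hu₁'
  rw [G₁.hρ₀ a, h₁, zero_add] at h₁'
  exact hd₁ h₁'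

/-! ## Exchanging the two privates of a chord -/

/-- The chord system with the two privates of `e₀` exchanged. -/
def swap (S : ChordSystem ι A) (e₀ : ι) : ChordSystem ι A where
  u := S.u
  ρ e := if e = e₀ then S.ρ' e else S.ρ e
  ρ' e := if e = e₀ then S.ρ e else S.ρ' e
  F := S.F
  t := S.t

/-- Unfolding `swap`. -/
@[simp] theorem swap_u (S : ChordSystem ι A) (e₀ : ι) : (swap S e₀).u = S.u := rfl
/-- Unfolding `swap`. -/
@[simp] theorem swap_t (S : ChordSystem ι A) (e₀ : ι) : (swap S e₀).t = S.t := rfl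
/-- Unfolding `swap` at `e₀`. -/
@[simp] theorem swap_ρ_self (S : ChordSystem ι A) (e₀ : ι) (a : A) : (swap S e₀).ρ e₀ a = S.ρ' e₀ a := by simp [swap]
/-- Unfolding `swap` at `e₀`. -/
@[simp] theorem swap_ρ'_self (S : ChordSystem ι A) (e₀ : ι) (a : A) : (swap S e₀).ρ' e₀ a = S.ρ e₀ a := by simp [swap]
/-- Unfolding `swap` off `e₀`. -/
theorem swap_ρ_of_ne (S : ChordSystem ι A) {e₀ e : ι} (h : e ≠ e₀) (a : A) : (swap S e₀).ρ e a = S.ρ e a := by simp [swap, h]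
/-- Unfolding `swap` off `e₀`. -/
theorem swap_ρ'_of_ne (S : ChordSystem ι A) {e₀ e : ι} (h : e ≠ e₀) (a : A) : (swap S e₀).ρ' e a = S.ρ' e a := by simp [swap, h]

/-- The state map realising the exchange: swap the two coordinates of the state of `e₀`. -/
def swapState (e₀ : ι) (s : ι → ZMod 2 × ZMod 2) : ι → ZMod 2 × ZMod 2 :=
  fun e => if e = e₀ then ((s e).2, (s e).1) else s e

/-- `swapState` is an involution. -/
theorem swapState_swapState (e₀ : ι) (s : ι → ZMod 2 × ZMod 2) : swapState e₀ (swapState e₀ s) = s := by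
  funext e
  by_cases h : e = e₀ <;> simp [swapState, h]

/-- Admissibility is invariant under the exchange. -/
theorem adm_swap (S : ChordSystem ι A) (e₀ : ι) (E : Finset ι) (a : A) (s : ι → ZMod 2 × ZMod 2) :
    (swap S e₀).Adm E a (swapState e₀ s) ↔ S.Adm E a s := by
  unfold ChordSystem.Adm
  refine forall₂_congr fun e _ => ?_
  by_cases h : e = e₀
  · simp [swapState, h, swap, mul_comm]
  · simp [swapState, h, swap]

/-- Contributions are invariant under the exchange. -/
theorem contrib_swap (S : ChordSystem ι A) (e₀ : ι) (a : A) (s : ι → ZMod 2 × ZMod 2) (e : ι) :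
    (swap S e₀).contrib a (swapState e₀ s) e = S.contrib a s e := by
  unfold ChordSystem.contrib
  by_cases h : e = e₀
  · subst h; simp [swapState, swap, add_comm]
  · simp [swapState, h, swap]

/-- Values are invariant under the exchange. -/
theorem val_swap (S : ChordSystem ι A) (e₀ : ι) (E : Finset ι) (a : A) (s : ι → ZMod 2 × ZMod 2) :
    (swap S e₀).val E a (swapState e₀ s) = S.val E a s := by
  unfold ChordSystem.val
  exact congrArg _ (sum_congr rfl fun e _ => contrib_swap S e₀ a s e)

/-- **Infeasibility is invariant under exchanging the privates of a chord.** -/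
theorem infeasible_swap (S : ChordSystem ι A) (e₀ : ι) (E : Finset ι) : (swap S e₀).Infeasible E ↔ S.Infeasible E := by
  constructor
  · intro h a s hadm hval
    exact h a (swapState e₀ s) ((adm_swap S e₀ E a s).2 hadm) (by rw [val_swap]; exact hval)
  · intro h a s hadm hval
    have hadm' : S.Adm E a (swapState e₀ s) := by
      rw [← adm_swap S e₀ E a, swapState_swapState]; exact hadm
    refine h a (swapState e₀ s) hadm' ?_
    rw [← val_swap S e₀ E a, swapState_swapState]; exact hval

/-- **Chord-minimality is invariant under exchanging the privates of a chord.** -/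
theorem chordMinimal_swap (S : ChordSystem ι A) (e₀ : ι) (E : Finset ι) (e : ι) :
    (swap S e₀).ChordMinimal E e ↔ S.ChordMinimal E e := by
  constructor
  · rintro ⟨a, s, hadm, hval⟩
    refine ⟨a, swapState e₀ s, ?_, ?_⟩
    · rw [← adm_swap S e₀ (E.erase e) a, swapState_swapState]; exact hadm
    · rw [← val_swap S e₀ E a, swapState_swapState]; exact hval
  · rintro ⟨a, s, hadm, hval⟩
    exact ⟨a, swapState e₀ s, (adm_swap S e₀ (E.erase e) a s).2 hadm, by rw [val_swap]; exact hval⟩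

/-- A gate on the SECOND private of `e₀` is a gate (on the first private) of the exchanged system. -/
theorem gate_swap {S : ChordSystem ι A} {φ : A → A} {e₀ : ι} {d : V2} {δ : A → V2}
    (hu : ∀ e a, S.u e (φ a) = S.u e a) (hF : ∀ a, S.F (φ a) = S.F a + δ a) (hρ : ∀ e a, S.ρ e (φ a) = S.ρ e a)
    (hρ' : ∀ e a, e ≠ e₀ → S.ρ' e (φ a) = S.ρ' e a) (hρ₀' : ∀ a, S.ρ' e₀ (φ a) = S.ρ' e₀ a + d) :
    Gate (swap S e₀) φ e₀ d δ where
  hu := hu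
  hF := hF
  hρ e a hne := by rw [swap_ρ_of_ne S hne, swap_ρ_of_ne S hne, hρ]
  hρ' e a := by
    by_cases h : e = e₀
    · subst h; rw [swap_ρ'_self, swap_ρ'_self, hρ]
    · rw [swap_ρ'_of_ne S h, swap_ρ'_of_ne S h, hρ' e a h]
  hρ₀ a := by rw [swap_ρ_self, swap_ρ_self, hρ₀']

end Summit.PneNP.PneNP.Theorems.PstarChordSystemGate
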